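import Mathlib
import HarnessLib
import Summits.Ventures.LatticeQCDFlow.Exactness.SU2KickCalculus

/-!
# Calculus for the `SU(2)` kick, all orders: `cos(ε√(w·w))` and `sinc(ε√(w·w))` are `C^∞` (indeed entire) functions on `ℝ³`; Lüscher's determinant in `sinc` form is `C^n` on `ℝ⁴` for every `n`

HONEST FRAMING: exact (Metropolis-corrected) sampling algorithms for lattice gauge theory;
figures of merit are autocorrelation/cost numbers at stated couplings and volumes; no
continuum-physics claim.

Venture `LatticeQCDFlow` (cell pub-lqcd), topic `Exactness`; FANOUT row 14 (`eng-flowhmc`).  NEW WORK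
of the cell over Mathlib (`FormalMultilinearSeries.ofScalars`, `ofScalars_radius_eq_top_of_tendsto`,
`Real.hasSum_cos` / `Real.hasSum_sin`, `AnalyticAt.contDiffAt`); nothing is cited as a fact; no number.
Support file for the HIGHER smoothness of the LO member's pulled-back action (`SU2KickCalculus` /
`SU2WilsonFlowLOSmooth` settled differentiability and listed "higher smoothness (true, not needed)" as
NOT CLAIMED; it IS needed for a Lipschitz constant of the exact force through the member, the sequel).
The only non-polynomial ingredients of the booked density are `cos(ε√s)` and `sinc(ε√s)` of
`s = |j⃗|²`; written as power series IN `s` they are entire: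
`cos √s = Σ (−s)ᵏ/(2k)!`, `sinc √s = Σ (−s)ᵏ/(2k+1)!` (`s ≥ 0`).

* §1 the two scalar series `FormalMultilinearSeries.ofScalarsSum (fun k => (−1)ᵏ/(2k)!)` and
  `(fun k => (−1)ᵏ/(2k+1)!)` on `ℝ`: infinite radius (ratio test), `C^n` for every `n`
  (`contDiff_cosSqrtSeries`, `contDiff_sincSqrtSeries`), and their values
  **`cosSqrtSeries_sq`** (`= cos t` at `t²`), **`sincSqrtSeries_sq`** (`= sinc t` at `t²`);
* §2 **`contDiff_cos_sqrt_dotProduct`**, **`contDiff_sinc_sqrt_dotProduct`** (on `Fin 3 → ℝ`, every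
  `n`), **`contDiff_luscherSinc`** — Lüscher's determinant
  `(1 − εj₀)(cos(ε|j⃗|) − j₀ ε sinc(ε|j⃗|))²` in the letters of `su2KickJacFix_eq_luscherSinc` is `C^n`
  on `ℝ⁴` for every `n`.

NOT CLAIMED: any bound on derivatives (none is computed); any number.
-/

noncomputable section

namespace Summit.Ventures.LatticeQCDFlow.Exactness

open Filter Topology FormalMultilinearSeries
open scoped Nat

set_option backward.isDefEq.respectTransparency false

/-! ## §1 Two entire scalar series: `cos √s` and `sinc √s` as functions of `s` -/

section Series

/-- `‖(−1)ᵏ/m!‖ = 1/m!`. -/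
theorem norm_neg_one_pow_div_factorial (k m : ℕ) : ‖((-1 : ℝ) ^ k / (m ! : ℝ))‖ = 1 / (m ! : ℝ) := by
  rw [norm_div, norm_pow, norm_neg, norm_one, one_pow, Real.norm_of_nonneg (Nat.cast_nonneg _)]

/-- Ratio of consecutive `cos √s` coefficients: `1/((2k+1)(2k+2))`. -/
theorem cosSqrtCoeff_ratio (k : ℕ) :
    ‖((-1 : ℝ) ^ (k + 1) / ((2 * (k + 1))! : ℝ))‖ / ‖((-1 : ℝ) ^ k / ((2 * k)! : ℝ))‖ =
      1 / ((2 * k + 1 : ℝ) * (2 * k + 2)) := by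
  rw [norm_neg_one_pow_div_factorial, norm_neg_one_pow_div_factorial]
  have h : (2 * (k + 1))! = (2 * k + 2) * ((2 * k + 1) * (2 * k)!) := by
    rw [show 2 * (k + 1) = (2 * k + 1) + 1 by ring, Nat.factorial_succ, Nat.factorial_succ]
  rw [h]
  have hf : (0 : ℝ) < (2 * k)! := Nat.cast_pos.2 (Nat.factorial_pos _)
  push_cast
  field_simp

/-- Ratio of consecutive `sinc √s` coefficients: `1/((2k+2)(2k+3))`. -/
theorem sincSqrtCoeff_ratio (k : ℕ) :
    ‖((-1 : ℝ) ^ (k + 1) / ((2 * (k + 1) + 1)! : ℝ))‖ / ‖((-1 : ℝ) ^ k / ((2 * k + 1)! : ℝ))‖ =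
      1 / ((2 * k + 2 : ℝ) * (2 * k + 3)) := by
  rw [norm_neg_one_pow_div_factorial, norm_neg_one_pow_div_factorial]
  have h : (2 * (k + 1) + 1)! = (2 * k + 3) * ((2 * k + 2) * (2 * k + 1)!) := by
    rw [show 2 * (k + 1) + 1 = (2 * k + 2) + 1 by ring, Nat.factorial_succ,
      show 2 * k + 2 = (2 * k + 1) + 1 by ring, Nat.factorial_succ]
  rw [h]
  have hf : (0 : ℝ) < (2 * k + 1)! := Nat.cast_pos.2 (Nat.factorial_pos _)
  push_cast
  field_simp

/-- A sequence squeezed between `0` and `1/(k+1)` tends to `0`. -/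
theorem tendsto_zero_of_le_one_div_succ {u : ℕ → ℝ} (h0 : ∀ k, 0 ≤ u k) (h1 : ∀ k, u k ≤ 1 / ((k : ℝ) + 1)) :
    Tendsto u atTop (𝓝 0) :=
  tendsto_of_tendsto_of_tendsto_of_le_of_le tendsto_const_nhds tendsto_one_div_add_atTop_nhds_zero_nat h0 h1

/-- The `cos √s` series has infinite radius of convergence. -/
theorem cosSqrtSeries_radius : (ofScalars ℝ (fun k : ℕ => ((-1 : ℝ) ^ k / ((2 * k)! : ℝ)))).radius = ⊤ := by
  refine ofScalars_radius_eq_top_of_tendsto ℝ _ (Eventually.of_forall fun k => ?_) ?_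
  · exact div_ne_zero (pow_ne_zero _ (by norm_num)) (Nat.cast_ne_zero.2 (Nat.factorial_ne_zero _))
  · have h : (fun k : ℕ => ‖((-1 : ℝ) ^ k.succ / ((2 * k.succ)! : ℝ))‖ / ‖((-1 : ℝ) ^ k / ((2 * k)! : ℝ))‖) =
        fun k : ℕ => 1 / ((2 * k + 1 : ℝ) * (2 * k + 2)) := by
      funext k; exact cosSqrtCoeff_ratio k
    rw [h]
    refine tendsto_zero_of_le_one_div_succ (fun k => by positivity) fun k => ?_
    rw [div_le_div_iff₀ (by positivity) (by positivity)]
    nlinarith [sq_nonneg (k : ℝ), (Nat.cast_nonneg k : (0 : ℝ) ≤ k)]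

/-- The `sinc √s` series has infinite radius of convergence. -/
theorem sincSqrtSeries_radius : (ofScalars ℝ (fun k : ℕ => ((-1 : ℝ) ^ k / ((2 * k + 1)! : ℝ)))).radius = ⊤ := by
  refine ofScalars_radius_eq_top_of_tendsto ℝ _ (Eventually.of_forall fun k => ?_) ?_
  · exact div_ne_zero (pow_ne_zero _ (by norm_num)) (Nat.cast_ne_zero.2 (Nat.factorial_ne_zero _))
  · have h : (fun k : ℕ => ‖((-1 : ℝ) ^ k.succ / ((2 * k.succ + 1)! : ℝ))‖ / ‖((-1 : ℝ) ^ k / ((2 * k + 1)! : ℝ))‖) =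
        fun k : ℕ => 1 / ((2 * k + 2 : ℝ) * (2 * k + 3)) := by
      funext k; exact sincSqrtCoeff_ratio k
    rw [h]
    refine tendsto_zero_of_le_one_div_succ (fun k => by positivity) fun k => ?_
    rw [div_le_div_iff₀ (by positivity) (by positivity)]
    nlinarith [sq_nonneg (k : ℝ), (Nat.cast_nonneg k : (0 : ℝ) ≤ k)]

/-- A scalar series with infinite radius is `C^n` for every `n`. -/
theorem contDiff_ofScalarsSum_of_radius_eq_top {c : ℕ → ℝ} (hc : (ofScalars ℝ c).radius = ⊤) {n : WithTop ℕ∞} :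
    ContDiff ℝ n (ofScalarsSum (E := ℝ) c) := by
  have hball : HasFPowerSeriesOnBall (ofScalarsSum (E := ℝ) c) (ofScalars ℝ c) 0 ⊤ := by
    have h := (ofScalars ℝ c).hasFPowerSeriesOnBall (by rw [hc]; exact ENNReal.zero_lt_top)
    rwa [hc] at h
  exact contDiff_iff_contDiffAt.2 fun x =>
    (hball.analyticAt_of_mem (by rw [Metric.mem_eball]; exact edist_lt_top x 0)).contDiffAt

/-- `s ↦ Σ (−s)ᵏ/(2k)!` is `C^n` for every `n`. -/
theorem contDiff_cosSqrtSeries {n : WithTop ℕ∞} : ContDiff ℝ n (ofScalarsSum (E := ℝ) (fun k : ℕ => ((-1 : ℝ) ^ k / ((2 * k)! : ℝ)))) :=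
  contDiff_ofScalarsSum_of_radius_eq_top cosSqrtSeries_radius

/-- `s ↦ Σ (−s)ᵏ/(2k+1)!` is `C^n` for every `n`. -/
theorem contDiff_sincSqrtSeries {n : WithTop ℕ∞} : ContDiff ℝ n (ofScalarsSum (E := ℝ) (fun k : ℕ => ((-1 : ℝ) ^ k / ((2 * k + 1)! : ℝ)))) :=
  contDiff_ofScalarsSum_of_radius_eq_top sincSqrtSeries_radius

/-- **`Σ (−1)ᵏ t^{2k}/(2k)! = cos t`**: the `cos √s` series at `s = t²`. -/
theorem cosSqrtSeries_sq (t : ℝ) : ofScalarsSum (E := ℝ) (fun k : ℕ => ((-1 : ℝ) ^ k / ((2 * k)! : ℝ))) (t ^ 2) = Real.cos t := by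
  rw [ofScalars_sum_eq]
  have h := Real.hasSum_cos t
  have hterm : (fun k : ℕ => ((-1 : ℝ) ^ k / ((2 * k)! : ℝ)) • (t ^ 2) ^ k) =
      fun k : ℕ => (-1) ^ k * t ^ (2 * k) / ((2 * k)! : ℝ) := by
    funext k
    rw [smul_eq_mul, ← pow_mul]
    ring
  rw [hterm]
  exact h.tsum_eq

/-- **`Σ (−1)ᵏ t^{2k}/(2k+1)! = sinc t`**: the `sinc √s` series at `s = t²`. -/
theorem sincSqrtSeries_sq (t : ℝ) : ofScalarsSum (E := ℝ) (fun k : ℕ => ((-1 : ℝ) ^ k / ((2 * k + 1)! : ℝ))) (t ^ 2) = Real.sinc t := by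
  by_cases ht : t = 0
  · subst ht
    rw [show (0 : ℝ) ^ 2 = 0 by norm_num, ofScalarsSum_zero, Real.sinc_zero]
    simp
  rw [Real.sinc_of_ne_zero ht, ofScalars_sum_eq]
  have h := (Real.hasSum_sin t).div_const t
  have hterm : (fun k : ℕ => ((-1 : ℝ) ^ k / ((2 * k + 1)! : ℝ)) • (t ^ 2) ^ k) =
      fun k : ℕ => (-1) ^ k * t ^ (2 * k + 1) / ((2 * k + 1)! : ℝ) / t := by
    funext k
    rw [smul_eq_mul, ← pow_mul, pow_succ]
    field_simp
  rw [hterm]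
  exact h.tsum_eq

/-- `cos (ε √s) = Σ (−ε²s)ᵏ/(2k)!` for `s ≥ 0`. -/
theorem cos_mul_sqrt_eq_cosSqrtSeries (ε : ℝ) {s : ℝ} (hs : 0 ≤ s) :
    Real.cos (ε * Real.sqrt s) = ofScalarsSum (E := ℝ) (fun k : ℕ => ((-1 : ℝ) ^ k / ((2 * k)! : ℝ))) (ε ^ 2 * s) := by
  rw [← cosSqrtSeries_sq, mul_pow, Real.sq_sqrt hs]

/-- `sinc (ε √s) = Σ (−ε²s)ᵏ/(2k+1)!` for `s ≥ 0`. -/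
theorem sinc_mul_sqrt_eq_sincSqrtSeries (ε : ℝ) {s : ℝ} (hs : 0 ≤ s) :
    Real.sinc (ε * Real.sqrt s) = ofScalarsSum (E := ℝ) (fun k : ℕ => ((-1 : ℝ) ^ k / ((2 * k + 1)! : ℝ))) (ε ^ 2 * s) := by
  rw [← sincSqrtSeries_sq, mul_pow, Real.sq_sqrt hs]

/-! ## §2 On `ℝ³` and `ℝ⁴`: `cos(ε√(w·w))`, `sinc(ε√(w·w))`, Lüscher's determinant are `C^n` -/

/-- `w ↦ w · w` is `C^n` on `Fin 3 → ℝ`. -/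
theorem contDiff_dotProduct_self {n : WithTop ℕ∞} : ContDiff ℝ n (fun w : Fin 3 → ℝ => dotProduct w w) := by
  have h : (fun w : Fin 3 → ℝ => dotProduct w w) = fun w => ∑ i, w i * w i := by
    funext w; rfl
  rw [h]
  exact ContDiff.sum fun i _ => (contDiff_apply ℝ ℝ i).mul (contDiff_apply ℝ ℝ i)

/-- **`w ↦ cos (ε √(w · w))` is `C^n` on `ℝ³` for every `n`** (it is the entire series `Σ(−ε²w·w)ᵏ/(2k)!`). -/
theorem contDiff_cos_sqrt_dotProduct (ε : ℝ) {n : WithTop ℕ∞} :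
    ContDiff ℝ n (fun w : Fin 3 → ℝ => Real.cos (ε * √(dotProduct w w))) := by
  have h : (fun w : Fin 3 → ℝ => Real.cos (ε * √(dotProduct w w))) =
      fun w => ofScalarsSum (E := ℝ) (fun k : ℕ => ((-1 : ℝ) ^ k / ((2 * k)! : ℝ))) (ε ^ 2 * dotProduct w w) := by
    funext w
    exact cos_mul_sqrt_eq_cosSqrtSeries ε (dotProduct_self_nonneg_fin3 w)
  rw [h]
  exact contDiff_cosSqrtSeries.comp (contDiff_const.mul contDiff_dotProduct_self)

/-- **`w ↦ sinc (ε √(w · w))` is `C^n` on `ℝ³` for every `n`** (the entire series `Σ(−ε²w·w)ᵏ/(2k+1)!`). -/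
theorem contDiff_sinc_sqrt_dotProduct (ε : ℝ) {n : WithTop ℕ∞} :
    ContDiff ℝ n (fun w : Fin 3 → ℝ => Real.sinc (ε * √(dotProduct w w))) := by
  have h : (fun w : Fin 3 → ℝ => Real.sinc (ε * √(dotProduct w w))) =
      fun w => ofScalarsSum (E := ℝ) (fun k : ℕ => ((-1 : ℝ) ^ k / ((2 * k + 1)! : ℝ))) (ε ^ 2 * dotProduct w w) := by
    funext w
    exact sinc_mul_sqrt_eq_sincSqrtSeries ε (dotProduct_self_nonneg_fin3 w)
  rw [h]
  exact contDiff_sincSqrtSeries.comp (contDiff_const.mul contDiff_dotProduct_self)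

/-- **Lüscher's determinant in `sinc` form is a `C^n` function of `j ∈ ℝ⁴`, for every `n`** (the
letters of `SU2KickCalculus.su2KickJacFix_eq_luscherSinc`). -/
theorem contDiff_luscherSinc (ε : ℝ) {n : WithTop ℕ∞} :
    ContDiff ℝ n (fun j : R4 => (1 - ε * j 0) * (Real.cos (ε * √(dotProduct ![j 1, j 2, j 3] ![j 1, j 2, j 3])) -
        j 0 * (ε * Real.sinc (ε * √(dotProduct ![j 1, j 2, j 3] ![j 1, j 2, j 3])))) ^ 2) := by
  have hproj : ∀ k : Fin 4, ContDiff ℝ n (fun j : R4 => j k) := fun k =>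
    (EuclideanSpace.proj k : R4 →L[ℝ] ℝ).contDiff
  have hw : ContDiff ℝ n (fun j : R4 => (![j 1, j 2, j 3] : Fin 3 → ℝ)) := by
    refine contDiff_pi.mpr fun i => ?_
    fin_cases i
    · exact hproj 1
    · exact hproj 2
    · exact hproj 3
  have hcos := (contDiff_cos_sqrt_dotProduct ε (n := n)).comp hw
  have hsinc := (contDiff_sinc_sqrt_dotProduct ε (n := n)).comp hw
  exact ((contDiff_const.sub (contDiff_const.mul (hproj 0))).mul
    ((hcos.sub ((hproj 0).mul (contDiff_const.mul hsinc))).pow 2))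

end Series

/-! ## §3 On `ℝ³ = EuclideanSpace ℝ (Fin 3)`: the scalar coefficients `cos(ε‖A‖)`, `sinc(ε‖A‖)` of the closed-form Pauli exponential are `C^n` (appended, GEN-15)

Row 9's Pauli drift `expPauli A` has the closed form `cos‖A‖·1 + sinc‖A‖·(iA·σ)`
(`B10Eq18SigmaSU2Haar.exp_su2Coord`); its scalar coefficients are the functions of §2 read through the
Euclidean norm `‖A‖ = √(A·A)`, hence `C^n` on `ℝ³` for every `n`. -/

section Euclidean

/-- `‖A‖ = √(A·A)` for `A ∈ ℝ³` read as a plain vector. -/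
theorem norm_euclidean_three_eq_sqrt_dotProduct (A : EuclideanSpace ℝ (Fin 3)) :
    ‖A‖ = √(dotProduct (fun i => A i) (fun i => A i)) := by
  rw [EuclideanSpace.norm_eq]
  congr 1
  simp only [dotProduct, Real.norm_eq_abs, sq, abs_mul_abs_self]

/-- The coordinates of `ℝ³` read as a plain vector form a `C^n` map. -/
theorem contDiff_euclidean_three_coords {n : WithTop ℕ∞} :
    ContDiff ℝ n (fun A : EuclideanSpace ℝ (Fin 3) => (fun i => A i : Fin 3 → ℝ)) :=
  contDiff_pi.mpr fun i => (EuclideanSpace.proj i : EuclideanSpace ℝ (Fin 3) →L[ℝ] ℝ).contDiff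

/-- **`A ↦ cos(ε‖A‖)` is `C^n` on `ℝ³` for every `n`.** -/
theorem contDiff_cos_mul_norm_euclidean_three (ε : ℝ) {n : WithTop ℕ∞} :
    ContDiff ℝ n (fun A : EuclideanSpace ℝ (Fin 3) => Real.cos (ε * ‖A‖)) := by
  have h : (fun A : EuclideanSpace ℝ (Fin 3) => Real.cos (ε * ‖A‖)) =
      (fun w : Fin 3 → ℝ => Real.cos (ε * √(dotProduct w w))) ∘
        (fun A : EuclideanSpace ℝ (Fin 3) => (fun i => A i : Fin 3 → ℝ)) := by
    funext A
    rw [Function.comp_apply, norm_euclidean_three_eq_sqrt_dotProduct]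
  rw [h]
  exact (contDiff_cos_sqrt_dotProduct ε).comp contDiff_euclidean_three_coords

/-- **`A ↦ sinc(ε‖A‖)` is `C^n` on `ℝ³` for every `n`.** -/
theorem contDiff_sinc_mul_norm_euclidean_three (ε : ℝ) {n : WithTop ℕ∞} :
    ContDiff ℝ n (fun A : EuclideanSpace ℝ (Fin 3) => Real.sinc (ε * ‖A‖)) := by
  have h : (fun A : EuclideanSpace ℝ (Fin 3) => Real.sinc (ε * ‖A‖)) =
      (fun w : Fin 3 → ℝ => Real.sinc (ε * √(dotProduct w w))) ∘
        (fun A : EuclideanSpace ℝ (Fin 3) => (fun i => A i : Fin 3 → ℝ)) := by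
    funext A
    rw [Function.comp_apply, norm_euclidean_three_eq_sqrt_dotProduct]
  rw [h]
  exact (contDiff_sinc_sqrt_dotProduct ε).comp contDiff_euclidean_three_coords

end Euclidean

end Summit.Ventures.LatticeQCDFlow.Exactness
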